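import Summits.QuantumFields.YangMills.Theorems.BalabanUVNodesN07ChartTopBoxPlaquetteValues
import Literature.MathematicalPhysics.QuantumFieldTheory.Balaban1983to89.Node00.Record12BgRowMixedDataB
import HarnessLib

/-!
# N07 [B11] (= [15] = [Balaban1985Variational]) Sect. F — MODULE 69a₁ (`…ChartTopBoxPlaquetteValues` §2–§3) AT PRINT's [II] (2.3) DATUM: the vertex dichotomy WITH the «off `Ω_{m+1}^{(m+1)}`»
# conjunct, and «`M^{m+1} U` IS print's (7) field `Sect2.mixedFieldB (lamBondsSeq Ω k (m+1)) (W_{m+1}) (W_m)` on a bond between two good vertices off `Ω_{m+2}`» from the fibre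
# `AgreeOnB (lamBondsSeq Ω k) (Ū U) W` (S1c∕C2 of the (E1)∕(iii-b) work plan, director-ym №338∕№339; FLAG №16; LOCATE-HSEAM 5d3298b8d191f169; DOOR-LIST-E1 Tier C2)

Cell `pub-ymgap`, seat `pub-ymgap-dag-n07-e` g34 (FAN-OUT §N07 row s3; LANE OWNER of the K0 road chart side).  `--kind proof --supports stmt-QuantumFields-20541 --as helper` (K0⁷); count-neutral;
def-free.  PRINT-DATUM TWIN of `…N07ChartTopBoxPlaquetteValues` §2 `corner_dichotomy` ∕ §3 `iter_succ_eq_mixedField_of_corners`, `plaqHol_iter_succ_eq_mixedField` (FLAG №16 ∕ LOCATE-HSEAM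
5d3298b8d191f169); the (b)-instances stay landed and true on their own text.  No displayed premise is deleted or weakened: the fibre hypothesis `AgreeOn (genSet Ω k) (Ū U) W` ([III] (2.10) in
reading (b): agreement on every bond MEETING `Γ_j`) is REPLACED by the WEAKER `AgreeOnB (lamBondsSeq Ω k) (Ū U) W` (agreement on [II] (2.3)'s `Λ_j`-bonds only: «Λ_j = Ω_j^{(j)} ∖ Ω_{j+1}^{(j)}
… for the sets of sites and the sets of bonds», p. 224; ruling (α) of record — the DIFFERENCE of the bond sets, inward connectors belong to no `Λ_j`), and the price is DISPLAYED: the two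
end-points of the bond must be off `Ω_{m+2}` in F0a's spelling (`blockOf · ∉ pts (m+2) (Ω (m+2))`, below the top), and a «good vertex of the second kind» carries the conjunct
`v ∉ pts (m+1) (Ω (m+1))` that `corner_dichotomy`'s proof had in hand but did not export.  [15] = [Balaban1985Variational]; [II] = [Balaban1984PropagatorsII]; [III] = [Balaban1988Convergent];
[I] = [Balaban1987RG1].

WHY (DOOR-LIST-E1 Tier C2, the one place with content).  The chart road's DATA READERS transfer the data's (7) smallness to the minimiser's averages `M^j U` near the cube through the fibre.
Reading (b) gave agreement on every bond meeting `Γ_j`, so 69a₁ could read `M^{m+1}U = W_{m+1}` on any touching bond and `M^m U = W_m` on any bond under a good vertex.  Under (2.3) the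
agreement is only on `Λ`-bonds — NO deep end-point.  On the chart box of a print-margin-clean datum this costs nothing: every vertex of the box is off `Ω_{m+2}` (margin), so a touching bond
there IS a `Λ_{m+1}`-bond; and a vertex of the second kind is off `Ω_{m+1}^{(m+1)}` (that is how the dichotomy found it), so every level-`m` bond under two such vertices is a `Λ_m`-bond
(F0a's deepness at level `m` = «the block lies in `Ω_{m+1}^{(m+1)}`»).  This file re-proves 69a₁ §3 with exactly these two side conditions displayed; the (7) field in the conclusion is print's
`Sect2.mixedFieldB av (lamBondsSeq Ω k (m+1))` (§7′), which the print data predicate `Sect2.DataSmall7LamTop` reads.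

WHAT IS PROVED (sorry-free; no definition; axioms standard).  §1 ★ `corner_dichotomyB` (69a₁ `corner_dichotomy` with the second branch strengthened to `castSite t ∉ pts (m+1) (Ω (m+1)) ∧ …`);
`mem_lamBondsSeq_of_below` (a level-`m` bond under two second-kind vertices is a `Λ_m`-bond).  §2 ★★ `iter_succ_eq_mixedFieldB_of_corners`, ★★ `plaqHol_iter_succ_eq_mixedFieldB` (69a₁ §3 over
`AgreeOnB (lamBondsSeq Ω k)`, with the off-`Ω_{m+2}` side conditions; conclusions at `Sect2.mixedFieldB … (lamBondsSeq Ω k (m+1))`).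
HONEST SCOPE.  Elementary bookkeeping on the fibre; nothing of [15]'s analysis asserted; K0⁷ ∕ K1⁹ NOT closed; N07 NOT discharged; counts unmoved (typed 28∕28 · discharged 8∕28); one finite
𝕋⁴ programme at fixed ε — the route closes the conditional finite-𝕋⁴ rung `BalabanLadder.UV` ONLY; the YM mass gap (Clay) is NOT proved by any of this; nothing continuum ∕ ℝ⁴ ∕ OS.
No `sorry`, no `def`, no `instance`, no `notation`.

References: [15] (7) p. 278 L20–33, (13) p. 280, (144) p. 300, (147) p. 301, (160) p. 303; [II] (2.3) p. 224 L10–16; [III] (2.2) p. 255, (2.10)–(2.11) p. 256; [I] (0.1)–(0.4) pp. 251–253.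
-/

set_option autoImplicit false

noncomputable section
open scoped BigOperators Matrix.Norms.L2Operator

namespace Summit.QuantumFields.YangMills.BalabanUVNodes.N07ChartTopBoxPlaquetteValuesB

open Literature.MathematicalPhysics.QuantumFieldTheory.Balaban1983to89
open Literature.MathematicalPhysics.QuantumFieldTheory.Balaban1983to89.Node00
open Literature.MathematicalPhysics.QuantumFieldTheory.Balaban1983to89.B15DeterminingSets
open Literature.MathematicalPhysics.QuantumFieldTheory.Balaban1983to89.B15DeterminingSetsB
open T4Continuum (T4Family)
open T4AxialGaugeSmallField (castSite castSite_apply castSite_add_e boxPlaqs)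
open B15Eq112TorusCover (cover)
open B14DomainGeom (Pt)
open B7Prop1Explicit (e e_apply)
open B8Eq131Cubes (box bLo bHi)
open B5Eq118OneStroke (iterBlockOf iterBlockOf_succ)
open GaugeField (plaqHol)
open BlockAveraging (blockAvg_avg)
open B8Eq17ClassAkV1 (plaqsOf mem_plaqsOf)
open Summit.QuantumFields.YangMills.BalabanUVNodes.N07ChartTopBoxPlaquetteValues (iterBlockOf_cover_of_mem_unitBox embIter_castSite_mem_unitBox embIter_mem_unitBox_of_blockOf_eq
  corner_dichotomy)

/-! ## §1  The dichotomy at a vertex, with the «off `Ω_{m+1}^{(m+1)}`» conjunct; `Λ_m`-bonds under second-kind vertices -/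

section Dichotomy

variable {P : Params} {m k : ℕ} (Ω : ℕ → Set (Site P 0))

/-- ★ **THE DICHOTOMY AT A VERTEX, SECOND BRANCH STRENGTHENED** (`j = m + 1 ≤ k`, standing range): under the margin, saturation and collar hypotheses of 69a₁ `corner_dichotomy`, EITHER the vertex
`castSite t` lies in `Γ_j^{(j)}` OR it lies OFF `Ω_j^{(j)}` AND every level-`m` site whose block is `castSite t` lies in `Γ_m^{(m)}` — the first conjunct of the second branch is what makes the
level-`m` bonds under such vertices `Λ_m`-bonds in F0a's spelling. [cite: Balaban1988Convergent, (2.2) p.255; Balaban1984PropagatorsII, (2.3) p.224; Balaban1985Variational, (7) p.278, (144) p.300] -/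
theorem corner_dichotomyB (hmk : m + 1 ≤ k) (hm : m + 1 ≤ P.m + P.K)
    (hsat : ∀ x x' : Site P 0, iterBlockOf (m + 1) x = iterBlockOf (m + 1) x' → x ∈ Ω (m + 1) → x' ∈ Ω (m + 1))
    {t : Pt P.d} (hfar : ∀ x ∈ box P.L t 1 (m + 1), cover P x ∉ Ω (m + 2)) (hcol : 1 ≤ m → ∀ x ∈ box P.L t 1 (m + 1), cover P x ∈ Ω m) :
    (castSite t : Site P (m + 1)) ∈ genSet Ω k (m + 1) ∨
      ((castSite t : Site P (m + 1)) ∉ pts (m + 1) (Ω (m + 1)) ∧ ∀ y : Site P m, blockOf y = (castSite t : Site P (m + 1)) → y ∈ genSet Ω k m) := by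
  by_cases hin : (castSite t : Site P (m + 1)) ∈ pts (m + 1) (Ω (m + 1))
  · -- the vertex is in `Ω_j^{(j)}`, and not in `Ω_{j+1}^{(j)}` by the margin: it is in `Γ_j`
    obtain ⟨xc, hxc, hce⟩ := embIter_castSite_mem_unitBox hm t
    left
    show (castSite t : Site P (m + 1)) ∈ pts (m + 1) (gammaRegion Ω k (m + 1))
    rw [mem_pts] at hin ⊢
    rcases Nat.eq_or_lt_of_le hmk with h | h
    · rw [h, gammaRegion_self]; rw [h] at hin; exact hin
    · rw [gammaRegion_mid Ω (by omega) h]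
      exact ⟨hin, by rw [hce]; exact hfar xc hxc⟩
  · rcases corner_dichotomy Ω hmk hm hsat hfar hcol with h | h
    · exact Or.inl h
    · exact Or.inr ⟨hin, h⟩

/-- A level-`m` bond whose two end-blocks are second-kind vertices (off `Ω_{m+1}^{(m+1)}`, all sites below in `Γ_m`) is a `Λ_m`-bond of [II] (2.3) (F0a `lamBondsSeq Ω k m`): it meets `Γ_m` and
neither end-point is deep. [cite: Balaban1984PropagatorsII, (2.3) p.224; Balaban1988Convergent, (2.2) p.255] -/
theorem mem_lamBondsSeq_of_below {b : PBond P m} {v₁ v₂ : Site P (m + 1)}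
    (hv₁ : v₁ ∉ pts (m + 1) (Ω (m + 1)) ∧ ∀ y : Site P m, blockOf y = v₁ → y ∈ genSet Ω k m)
    (hv₂ : v₂ ∉ pts (m + 1) (Ω (m + 1)) ∧ ∀ y : Site P m, blockOf y = v₂ → y ∈ genSet Ω k m)
    (h₁ : blockOf b.src = v₁ ∨ blockOf b.src = v₂) (h₂ : blockOf b.tgt = v₁ ∨ blockOf b.tgt = v₂) : b ∈ lamBondsSeq Ω k m := by
  refine ⟨Or.inl ?_, fun _ => ⟨?_, ?_⟩⟩
  · rcases h₁ with h | h
    · exact hv₁.2 _ h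
    · exact hv₂.2 _ h
  · rcases h₁ with h | h
    · rw [h]; exact hv₁.1
    · rw [h]; exact hv₂.1
  · rcases h₂ with h | h
    · rw [h]; exact hv₁.1
    · rw [h]; exact hv₂.1

end Dichotomy

/-! ## §2  Bond and plaquette values over `AgreeOnB (lamBondsSeq Ω k)`: `M^{m+1} U = ` print's (7) field `Sect2.mixedFieldB (lamBondsSeq Ω k (m+1))` on the chart box -/

section Values

variable (F : T4Family) (N : ℕ) [NeZero N] (K : ℕ) {m k : ℕ} (Ω : ℕ → Set (Site (F.P K) 0)) (W : MSField (F.P K) (SU N)) (U : GaugeField (F.P K) 0 (SU N))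

/-- ★★ **ON A LEVEL-`(m+1)` BOND BETWEEN TWO GOOD VERTICES OFF `Ω_{m+2}`, `M^{m+1} U` IS PRINT's (7) FIELD** `Sect2.mixedFieldB (lamBondsSeq Ω k (m+1)) (W_{m+1}) (W_m)`, from the (2.3) fibre
`AgreeOnB (lamBondsSeq Ω k) (Ū U) W`: if the bond meets `Γ_{m+1}` it is a `Λ_{m+1}`-bond (no end-point deep, by `hoffs ∕ hofft`) and both sides are `W_{m+1}`; otherwise both vertices are of
the second kind, every level-`m` bond under them is a `Λ_m`-bond (§1), and both sides are the one-step average of `W_m = M^m U` there (two-block locality of (0.4)).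
[cite: Balaban1985Variational, (7) p.278 L26–33, (13) p.280; Balaban1984PropagatorsII, (2.3) p.224; Balaban1988Convergent, (2.10)–(2.11) p.256; Balaban1987RG1, (0.4) p.253] -/
theorem iter_succ_eq_mixedFieldB_of_corners (hm : m + 1 ≤ (F.P K).m + (F.P K).K) (hfib : AgreeOnB (lamBondsSeq Ω k) (avgFamily (avOfRecord F N K) U) W)
    (b : PBond (F.P K) (m + 1))
    (hsrc : b.src ∈ genSet Ω k (m + 1) ∨
      (b.src ∉ pts (m + 1) (Ω (m + 1)) ∧ ∀ y : Site (F.P K) m, blockOf y = b.src → y ∈ genSet Ω k m))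
    (htgt : b.tgt ∈ genSet Ω k (m + 1) ∨
      (b.tgt ∉ pts (m + 1) (Ω (m + 1)) ∧ ∀ y : Site (F.P K) m, blockOf y = b.tgt → y ∈ genSet Ω k m))
    (hoffs : m + 1 < k → blockOf b.src ∉ pts (m + 1 + 1) (Ω (m + 1 + 1))) (hofft : m + 1 < k → blockOf b.tgt ∉ pts (m + 1 + 1) (Ω (m + 1 + 1))) :
    Averaging.iter (avOfRecord F N K) (m + 1) U b = Sect2.mixedFieldB (avOfRecord F N K) (lamBondsSeq Ω k (m + 1)) (W (m + 1)) (W m) b := by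
  by_cases hb : b ∈ bondsOf (genSet Ω k (m + 1))
  · -- a touching bond with no deep end-point: a `Λ_{m+1}`-bond
    have hb' : b ∈ lamBondsSeq Ω k (m + 1) := ⟨hb, fun h => ⟨hoffs h, hofft h⟩⟩
    rw [Sect2.mixedFieldB_of_mem _ _ _ hb']
    exact hfib (m + 1) b hb'
  · have hb' : b ∉ lamBondsSeq Ω k (m + 1) := fun h => hb h.1
    rw [Sect2.mixedFieldB_of_not_mem _ _ _ hb']
    -- both ends are OFF `Γ_{m+1}`: second-kind vertices
    have hs' : b.src ∉ pts (m + 1) (Ω (m + 1)) ∧ ∀ y : Site (F.P K) m, blockOf y = b.src → y ∈ genSet Ω k m := by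
      rcases hsrc with h | h
      · exact absurd (Or.inl h) hb
      · exact h
    have ht' : b.tgt ∉ pts (m + 1) (Ω (m + 1)) ∧ ∀ y : Site (F.P K) m, blockOf y = b.tgt → y ∈ genSet Ω k m := by
      rcases htgt with h | h
      · exact absurd (Or.inr h) hb
      · exact h
    show (avOfRecord F N K m).avg (Averaging.iter (avOfRecord F N K) m U) b = (avOfRecord F N K m).avg (W m) b
    rw [avOfRecord_apply, blockAvg_avg]
    exact T4ReflectionConeSharp.avgFun_congr₂ _ hm _ _ b fun b' h₁ h₂ => hfib m b' (mem_lamBondsSeq_of_below Ω hs' ht' h₁ h₂)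

/-- ★★ **THE LEVEL-`(m+1)` PLAQUETTE OF `M^{m+1} U` AT A CHART-BOX PLAQUETTE IS PRINT's (7) PLAQUETTE** `(∂V)(p′)` with `V = W_{m+1}` on `Λ_{m+1}`, `V̄ = \overline{W_m}` elsewhere — all four
vertices good, none deep (below the top). [cite: Balaban1985Variational, (7) p.278 L20–33; Balaban1984PropagatorsII, (2.3) p.224; Balaban1988Convergent, (2.10) p.256] -/
theorem plaqHol_iter_succ_eq_mixedFieldB (hm : m + 1 ≤ (F.P K).m + (F.P K).K) (hfib : AgreeOnB (lamBondsSeq Ω k) (avgFamily (avOfRecord F N K) U) W)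
    (p : Plaq (F.P K) (m + 1))
    (hgood : ∀ y : Site (F.P K) (m + 1), (y = p.src ∨ y = p.src.shift p.μ ∨ y = p.src.shift p.ν ∨ y = (p.src.shift p.μ).shift p.ν) →
      (y ∈ genSet Ω k (m + 1) ∨ (y ∉ pts (m + 1) (Ω (m + 1)) ∧ ∀ y' : Site (F.P K) m, blockOf y' = y → y' ∈ genSet Ω k m)))
    (hoff : m + 1 < k → ∀ y : Site (F.P K) (m + 1), (y = p.src ∨ y = p.src.shift p.μ ∨ y = p.src.shift p.ν ∨ y = (p.src.shift p.μ).shift p.ν) →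
      blockOf y ∉ pts (m + 1 + 1) (Ω (m + 1 + 1))) :
    plaqHol (Averaging.iter (avOfRecord F N K) (m + 1) U) p = plaqHol (Sect2.mixedFieldB (avOfRecord F N K) (lamBondsSeq Ω k (m + 1)) (W (m + 1)) (W m)) p := by
  have hcomm : (p.src.shift p.ν).shift p.μ = (p.src.shift p.μ).shift p.ν := by
    have hne : p.μ ≠ p.ν := p.hμν.ne
    simp only [Site.shift, Function.update_of_ne hne, Function.update_of_ne hne.symm]
    exact (Function.update_comm hne _ _ _).symm
  have e1 := iter_succ_eq_mixedFieldB_of_corners F N K Ω W U hm hfib ⟨p.src, p.μ⟩ (hgood _ (Or.inl rfl)) (hgood _ (Or.inr (Or.inl rfl)))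
    (fun h => hoff h _ (Or.inl rfl)) (fun h => hoff h _ (Or.inr (Or.inl rfl)))
  have e2 := iter_succ_eq_mixedFieldB_of_corners F N K Ω W U hm hfib ⟨p.src.shift p.μ, p.ν⟩ (hgood _ (Or.inr (Or.inl rfl)))
    (hgood _ (Or.inr (Or.inr (Or.inr rfl)))) (fun h => hoff h _ (Or.inr (Or.inl rfl))) (fun h => hoff h _ (Or.inr (Or.inr (Or.inr rfl))))
  have e3 := iter_succ_eq_mixedFieldB_of_corners F N K Ω W U hm hfib ⟨p.src.shift p.ν, p.μ⟩ (hgood _ (Or.inr (Or.inr (Or.inl rfl))))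
    (hgood _ (Or.inr (Or.inr (Or.inr (by show (p.src.shift p.ν).shift p.μ = _; rw [hcomm])))))
    (fun h => hoff h _ (Or.inr (Or.inr (Or.inl rfl)))) (fun h => hoff h _ (Or.inr (Or.inr (Or.inr (by show (p.src.shift p.ν).shift p.μ = _; rw [hcomm])))))
  have e4 := iter_succ_eq_mixedFieldB_of_corners F N K Ω W U hm hfib ⟨p.src, p.ν⟩ (hgood _ (Or.inl rfl)) (hgood _ (Or.inr (Or.inr (Or.inl rfl))))
    (fun h => hoff h _ (Or.inl rfl)) (fun h => hoff h _ (Or.inr (Or.inr (Or.inl rfl))))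
  unfold GaugeField.plaqHol
  rw [e1, e2, e3, e4]

end Values

end Summit.QuantumFields.YangMills.BalabanUVNodes.N07ChartTopBoxPlaquetteValuesB

end
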